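import Literature.NumberTheory.EllipticCurves.OggFormulaTwistTameIstarTwoProofs
import Literature.NumberTheory.DiophantineGeometry.TateAlgorithmIstarSuccNormalFormProofs
import HarnessLib

/-!
# Ogg's formula at `2` over `ℚ`: the `C₆`-curves of Kodaira type `I₄*` (`ord₂ Δ_min = 14`)

`Proofs` file (theorems only, no definitions, no named facts, no instances) in topic
`NumberTheory/EllipticCurves`, in the series `OggFormulaTameTypesTwoProofs`, `OggFormulaTwistTameTwoProofs`,
`OggFormulaTwistTameIstarTwoProofs`, `OggFormulaTwistTameIIstarTwoProofs` (same seat: the C15 fact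
`WeierstrassCurve.conductorNatOf_geomPoints_eq_conductorNorm_of_isElliptic W ℓ`, `HasseWeilAbelian`;
Serre–Tate 1968 §3, Silverman *ATAEC* §IV.10 and Ogg's formula IV.11.1).

## Context

The twists by `χ_{±2}` of the tame curves of type `IV*` (inertia `C₆` on `E[3]`, `δ₂ = 4`) have
`ord₂ Δ_min = 14` and are of type `II*` when `a₁/2` is even (`OggFormulaTwistTameIIstarTwoProofs`) and of
type **`I₄*`** when `a₁/2` is odd: `E₁ : (a₁, …, a₆) = (2α₀, 4p₀, 4γ₀, 8q₀, 16r₀)`, `α₀, γ₀` odd, gives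
`E₁^{(2ε)} : y² = x³ + 2ε(α₀² + 4p₀)x² + 16(2q₀ + α₀γ₀)x + 32ε(γ₀² + 4r₀)` — `a₂/2`, `a₄/16`, `a₆/32`
odd, the Step-7 shape with cubic `T²(T + 1)`.  This file proves Ogg's formula for the curves of type
`Iₙ*` in this shape.

## The argument (Silverman *ATAEC* IV.9.4 Step 7 with `π = 2`; Thm. IV.10.2(b), twist case)

* **The gauge** (§1, over a DVR in which `2` is a uniformiser, perfect residue field; §2, transfer).
  A curve of type `Iₙ*`, `n ≥ 1`, has a Step-7 model `2 ∣ a₁`, `a₂ = 2·unit`, `4 ∣ a₃`, `8 ∣ a₄`,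
  `16 ∣ a₆` (the tree's `exists_smul_of_kodairaSymbolOfMinimal_eq_Istar_succ`); when `4 ∣ a₁` and
  `8 ∣ a₃`, `y ↦ y - a₃/2` reaches `a₃ = 0` inside this shape (`exists_smul_a₃_eq_zero_of_step7`).  The
  transfer lemma is extended by the exact shapes of `a₂` and `a₄`
  (`exists_variableChange_valuation_shape_of_two'`), and a gauge model with `a₄ = 16·unit`,
  `a₆ = 32·unit`, `ord Δ = 14` becomes a `ℚ`-model with `ord₂(a₁) ≥ 2`, `ord₂(a₂) = 1`, `ord₂(a₃) ≥ 7`,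
  `ord₂(a₄) = 4`, `ord₂(a₆) = 5`, `ord₂ Δ = 14` and the signs of the `2`-adic units `a₆/32`, `b₂/8`
  (`exists_variableChange_of_Istar_succ_gauge`).
* **The twist** (§2).  If `a₆/32 ≡ b₂/8 ≡ ε (mod 4)` — the `C₆`-condition — then, with `a₁ = 4α₁`,
  `a₂ = 2P`, `a₄ = 16q`, `a₆ = 32r`, the twist `W^{(2ε)}` has `a₂ = 4ε(P + 2α₁²)`, `a₄ = 64q + ⋯`,
  `a₆ = 256εr + ⋯`, and under `(u; r, s, t) = (2; 0, 2, 16)` it acquires the shape `a₁' = 2`,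
  `a₂' = ε(P + 2α₁² - ε) ∈ 4ℤ₂`, `a₃' = 4`, `a₄' = 4((q - 1) + ⋯) ∈ 8ℤ₂`, `a₆' = 4(ε(r - ε) + ⋯) ∈ 16ℤ₂`,
  `ord₂ Δ' = 8` of type `IV*`; hence `W^{(2ε)}` is potentially good over `ℚ(∛2)`
  (`hasGoodReductionAt_baseChange_of_pow_three_eq`, `j = 2`) and `Sw_𝔓(V_ℓ E) = 2 · 2 = 4 = δ₂ = 14 - 10`.

## Main results (over `ℚ`, `v ∋ 2`)

* `LocalIndex.exists_smul_step7_of_kodairaSymbolOfMinimal_eq_Istar_succ_of_two`,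
  `LocalIndex.exists_smul_a₃_eq_zero_of_step7` (DVR level);
  `WeierstrassCurve.exists_variableChange_valuation_shape_of_two'` (transfer with exact `a₂`, `a₄`),
  `WeierstrassCurve.wildConductorExponent_eq_of_kodairaSymbolAt_Istar` (`δ = ord Δ_min - (n + 6)`),
  `WeierstrassCurve.exists_variableChange_of_Istar_succ_gauge`;
* `WeierstrassCurve.swanConductorAt_rationalTate_eq_four_of_Istar_four_fourteen`,
  `WeierstrassCurve.swanConductorAt_torsion_eq_wildConductorExponent_of_Istar_four_fourteen`
  — `Sw_𝔓(V_ℓ E) = 4` and `Sw_𝔓(E[3]) = δ₂ = 4` on the `C₆`-gauge of `(I₄*, 14)`.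

The other curves of type `Iₙ*` with `ord₂(j) > 0` are not treated here.  No definitions, no named
facts (D-0026).  All axioms `propext`, `Classical.choice`, `Quot.sound`.

## References

* J. H. Silverman, *Advanced Topics in the Arithmetic of Elliptic Curves*, GTM 151 (1994), IV.9.4
  (Tate's algorithm, Step 7) and Table 4.1; §IV.10 (Definition of `ε, δ, f`, PDF p. 358; Thm. 10.2(b)
  and its proof, pp. 359–362); §IV.11 (Ogg's formula 11.1, p. 365; `p = 2`, p. 366).
  [SilvermanATAEC1994]
* J. H. Silverman, *The Arithmetic of Elliptic Curves*, 2nd ed. (2009), VII.1 Remark 1.1,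
  VII.5 Prop. 5.4, X.5 Cor. 5.4. [SilvermanAEC2009]
* J.-P. Serre, J. Tate, *Good reduction of abelian varieties*, Ann. of Math. 88 (1968), §§2–3.
  [SerreTate1968]
* T. Saito, *Conductor, discriminant, and the Noether formula of arithmetic surfaces*, Duke Math.
  J. 57 (1988), Theorem 1 (cited only). [Saito1988]

## Design

Theorems only; `noncomputable section`.  §1 in `namespace Literature.NumberTheory.EllipticCurves.LocalIndex`
(DVR level, `2` a uniformiser); §2 (transfer) and §3 over `ℚ` in `namespace WeierstrassCurve`, with the
signatures of the previous files of the series.  Axioms: `propext`, `Classical.choice`, `Quot.sound`.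
-/

noncomputable section

open scoped Classical NumberField
open NumberField IsDedekindDomain Field WithZero


/-! ## §1. Type `Iₙ*` when `2` is a uniformiser: the Step-7 shape and the gauge `a₃ = 0` -/

section DVR

open IsLocalRing
open IsDiscreteValuationRing hiding maximalIdeal

namespace Literature.NumberTheory.EllipticCurves

namespace LocalIndex

open Literature.NumberTheory.DiophantineGeometry Literature.NumberTheory.DiophantineGeometry.TateAlgorithm
  Literature.NumberTheory.DiophantineGeometry.TateAlgorithm.CharTwo

variable {R : Type*} [CommRing R] [IsDomain R] [IsDiscreteValuationRing R]

/-- **Type `Iₙ*`, `n ≥ 1`, when `2` is a uniformiser: the Step-7 shape.**  If Tate's algorithm returns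
`Iₙ*` (`n ≥ 1`) on a minimal `V` then some `R`-model `D • V` has `2 ∣ a₁`, `a₂ = 2p` with `p ∈ R^×`,
`4 ∣ a₃`, `8 ∣ a₄`, `16 ∣ a₆` and the same `ord Δ` (the tree's
`exists_smul_of_kodairaSymbolOfMinimal_eq_Istar_succ` with `π = 2`).  Silverman, *ATAEC* IV.9.4
Step 7. [cite: SilvermanATAEC1994, IV.9.4 Step 7] -/
theorem exists_smul_step7_of_kodairaSymbolOfMinimal_eq_Istar_succ_of_two
    [PerfectField (ResidueField R)] (h2 : Irreducible (2 : R)) (V : WeierstrassCurve R) {n : ℕ}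
    (hV : V.kodairaSymbolOfMinimal = .Istar (n + 1)) :
    ∃ D : WeierstrassCurve.VariableChange R,
      2 ∣ (D • V).a₁ ∧ (∃ p : R, IsUnit p ∧ (D • V).a₂ = 2 * p) ∧ 2 ^ 2 ∣ (D • V).a₃ ∧
      2 ^ 3 ∣ (D • V).a₄ ∧ 2 ^ 4 ∣ (D • V).a₆ ∧ addVal R (D • V).Δ = addVal R V.Δ := by
  have hm : ∀ {x : R}, x ∈ maximalIdeal R ↔ (2 : R) ∣ x := fun {x} ↦
    mem_maximalIdeal_iff_dvd_of_irreducible h2 x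
  have hmn : ∀ {x : R} {n : ℕ}, x ∈ maximalIdeal R ^ n ↔ (2 : R) ^ n ∣ x := fun {x n} ↦
    mem_maximalIdeal_pow_iff_dvd_of_irreducible h2 x n
  obtain ⟨D, h₁, h₂, h₂', h₃, h₄, h₆⟩ := exists_smul_of_kodairaSymbolOfMinimal_eq_Istar_succ V hV
  rw [hm] at h₁ h₂
  rw [hmn] at h₂' h₃ h₄ h₆
  obtain ⟨p, hp⟩ := h₂
  have hpu : IsUnit p := by
    rw [isUnit_iff_not_dvd h2]
    rintro ⟨p', rfl⟩
    exact h₂' ⟨p', by rw [hp]; ring⟩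
  refine ⟨D, h₁, ⟨p, hpu, hp⟩, h₃, h₄, h₆, ?_⟩
  rw [WeierstrassCurve.variableChange_Δ, addVal_mul, addVal_pow, addVal_eq_zero_of_unit, nsmul_zero, zero_add]

omit [IsDomain R] [IsDiscreteValuationRing R] in
/-- **The gauge `a₃ = 0` on a Step-7 model with `4 ∣ a₁`, `8 ∣ a₃`.**  If `a₁ = 4α₁`, `a₃ = 8γ₁`,
`8 ∣ a₄`, `16 ∣ a₆` then `y ↦ y - 4γ₁` gives `a₃ = 0` keeping `a₁`, `a₂`, `8 ∣ a₄`, `16 ∣ a₆` and `Δ`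
(`a₄ ↦ a₄ + 16α₁γ₁`, `a₆ ↦ a₆ + 16γ₁²`). [folklore] -/
theorem exists_smul_a₃_eq_zero_of_step7 (W : WeierstrassCurve R) (h₁ : 2 ^ 2 ∣ W.a₁)
    (h₃ : 2 ^ 3 ∣ W.a₃) (h₄ : 2 ^ 3 ∣ W.a₄) (h₆ : 2 ^ 4 ∣ W.a₆) :
    ∃ C : WeierstrassCurve.VariableChange R, C.u = 1 ∧
      (C • W).a₁ = W.a₁ ∧ (C • W).a₂ = W.a₂ ∧ (C • W).a₃ = 0 ∧ 2 ^ 3 ∣ (C • W).a₄ ∧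
      2 ^ 4 ∣ (C • W).a₆ ∧ (C • W).Δ = W.Δ := by
  obtain ⟨α₁, hα⟩ := h₁
  obtain ⟨γ₁, hγ⟩ := h₃
  obtain ⟨q, hq⟩ := h₄
  obtain ⟨r, hr⟩ := h₆
  refine ⟨⟨1, 0, 0, -(4 * γ₁)⟩, rfl, ?_, ?_, ?_, ?_, ?_, ?_⟩
  · rw [WeierstrassCurve.variableChange_a₁]; simp
  · rw [WeierstrassCurve.variableChange_a₂]; simp
  · rw [WeierstrassCurve.variableChange_a₃, hγ, hα]; simp; ring
  · refine ⟨q + 2 * α₁ * γ₁, ?_⟩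
    rw [WeierstrassCurve.variableChange_a₄, hq, hγ, hα]; simp; ring
  · refine ⟨r + γ₁ ^ 2, ?_⟩
    rw [WeierstrassCurve.variableChange_a₆, hr, hq, hγ, hα]; simp; ring
  · rw [WeierstrassCurve.variableChange_Δ]; simp

end LocalIndex

end Literature.NumberTheory.EllipticCurves

end DVR

/-! ## §2. The transfer lemma with the exact shapes of `a₂`, `a₃`, `a₄`, `a₆`, `b₈` -/

section Transfer

open IsLocalRing
open IsDiscreteValuationRing hiding maximalIdeal

namespace WeierstrassCurve

open Literature.NumberTheory.EllipticCurves Literature.NumberTheory.DiophantineGeometry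
  Literature.NumberTheory.DiophantineGeometry.TateAlgorithm Literature.NumberTheory.GaloisRepresentations
  IsDedekindDomain.HeightOneSpectrum

section Dedekind

variable {A : Type*} [CommRing A] [IsDedekindDomain A] {K' : Type*} [Field K'] [Algebra A K']
  [IsFractionRing A K'] (v : HeightOneSpectrum A) (X : WeierstrassCurve K')

/-- **From an `𝒪_v`-model with `2`-power shapes to a `K`-model, with the exact shapes of `a₂`, `a₃`,
`a₄` (divisible mode with exactness clauses), `a₆`, `a₆ - c` and `b₈`** (`ord_v(2) = 1`): the statement of
`exists_variableChange_valuation_shape_of_two` (`OggFormulaTwistTameIstarTwoProofs`) with, moreover,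
`ord_v(a₂) = m` (resp. `ord_v(a₄) = m`) on the `K`-model whenever `a₂` (resp. `a₄`) of the `𝒪_v`-model is
`2^m·unit` (density of `K⁴` in `K_v⁴` and local constancy of the valuation).  Silverman, *AEC* VII.1
Remark 1.1; *ATAEC* IV.9.4. [cite: SilvermanAEC2009, VII.1 Remark 1.1] [cite: SilvermanATAEC1994, IV.9.4] -/
theorem exists_variableChange_valuation_shape_of_two' [X.IsElliptic]
    (h2 : v.valuation K' (2 : K') = exp (-1 : ℤ)) {k₁ k₂ k₃ k₄ k₆ k₈ n : ℕ}
    (D : VariableChange (v.adicCompletionIntegers K'))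
    (ha₁ : (2 : v.adicCompletionIntegers K') ^ k₁ ∣ (D • X.localMinimalIntegralModel v).a₁)
    (ha₂ : (2 : v.adicCompletionIntegers K') ^ k₂ ∣ (D • X.localMinimalIntegralModel v).a₂)
    (ha₃ : (2 : v.adicCompletionIntegers K') ^ k₃ ∣ (D • X.localMinimalIntegralModel v).a₃)
    (ha₄ : (2 : v.adicCompletionIntegers K') ^ k₄ ∣ (D • X.localMinimalIntegralModel v).a₄)
    (ha₆' : ∃ r : v.adicCompletionIntegers K', IsUnit r ∧
      (D • X.localMinimalIntegralModel v).a₆ = 2 ^ k₆ * r)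
    (c₆ : ℤ) {k₆' : ℕ}
    (ha₆c : (2 : v.adicCompletionIntegers K') ^ k₆' ∣ ((D • X.localMinimalIntegralModel v).a₆ - c₆))
    (hb₈ : (2 : v.adicCompletionIntegers K') ^ k₈ ∣ (D • X.localMinimalIntegralModel v).b₈)
    (hΔn : (addVal (v.adicCompletionIntegers K') (D • X.localMinimalIntegralModel v).Δ).toNat = n) :
    X.ordMinimalDiscriminant v = n ∧
    ∃ C : VariableChange K',
      v.valuation K' (C • X).a₁ ≤ exp (-(k₁ : ℤ)) ∧ v.valuation K' (C • X).a₂ ≤ exp (-(k₂ : ℤ)) ∧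
      (∀ {m : ℕ} {w : v.adicCompletionIntegers K'}, IsUnit w →
        (D • X.localMinimalIntegralModel v).a₂ = 2 ^ m * w → v.valuation K' (C • X).a₂ = exp (-(m : ℤ))) ∧
      v.valuation K' (C • X).a₃ ≤ exp (-(k₃ : ℤ)) ∧
      (∀ {m : ℕ} {w : v.adicCompletionIntegers K'}, IsUnit w →
        (D • X.localMinimalIntegralModel v).a₃ = 2 ^ m * w → v.valuation K' (C • X).a₃ = exp (-(m : ℤ))) ∧
      v.valuation K' (C • X).a₄ ≤ exp (-(k₄ : ℤ)) ∧
      (∀ {m : ℕ} {w : v.adicCompletionIntegers K'}, IsUnit w →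
        (D • X.localMinimalIntegralModel v).a₄ = 2 ^ m * w → v.valuation K' (C • X).a₄ = exp (-(m : ℤ))) ∧
      v.valuation K' (C • X).a₆ = exp (-(k₆ : ℤ)) ∧
      v.valuation K' ((C • X).a₆ - c₆) ≤ exp (-(k₆' : ℤ)) ∧
      v.valuation K' (C • X).b₈ ≤ exp (-(k₈ : ℤ)) ∧
      (∀ {m : ℕ} {w : v.adicCompletionIntegers K'}, IsUnit w →
        (D • X.localMinimalIntegralModel v).b₈ = 2 ^ m * w → v.valuation K' (C • X).b₈ = exp (-(m : ℤ))) ∧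
      v.valuation K' (C • X).Δ = exp (-(n : ℤ)) := by
  set φ := algebraMap K' (v.adicCompletion K') with hφ
  -- `2` is a uniformiser of `(v.adicCompletionIntegers K')`
  have h2v : Valued.v ((2 : (v.adicCompletionIntegers K')) : (v.adicCompletion K')) = exp (-1 : ℤ) := by
    have : ((2 : (v.adicCompletionIntegers K')) : (v.adicCompletion K')) = φ 2 := by rw [hφ, map_ofNat]; rfl
    rw [this, hφ, valued_algebraMap_adicCompletion, h2]
  have h2irr : Irreducible (2 : (v.adicCompletionIntegers K')) := irreducible_adicCompletionIntegers_of_valued_eq v 2 h2v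
  set M := X.localMinimalIntegralModel v with hM
  obtain ⟨r, hr, ha₆⟩ := ha₆'
  set N := D • M with hN
  -- `ord_v(Δ_min) = n`
  have hΔM0 : M.Δ ≠ 0 := localMinimalIntegralModel_Δ_ne_zero v X
  have hΔN : N.Δ = ↑D.u⁻¹ ^ 12 * M.Δ := by rw [hN, variableChange_Δ]
  have hordN : addVal (v.adicCompletionIntegers K') N.Δ = addVal (v.adicCompletionIntegers K') M.Δ := by
    rw [hΔN, addVal_mul, addVal_pow, addVal_eq_zero_of_unit, nsmul_zero, zero_add]
  have hord : X.ordMinimalDiscriminant v = n := by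
    rw [ordMinimalDiscriminant, ← hM, ← hordN, hΔn]
  refine ⟨hord, ?_⟩
  -- valuations of the coefficients of `N` in `K_v`
  have hle : ∀ {x : (v.adicCompletionIntegers K')} {k : ℕ}, (2 : (v.adicCompletionIntegers K')) ^ k ∣ x → Valued.v (x : (v.adicCompletion K')) ≤ exp (-(k : ℤ)) := by
    rintro x k ⟨y, rfl⟩
    push_cast
    rw [Valuation.map_mul, Valuation.map_pow, h2v, ← exp_nsmul, nsmul_eq_mul, mul_neg, mul_one]
    exact mul_le_of_le_one_right' ((mem_adicCompletionIntegers _ _ _).mp y.2)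
  have heq : ∀ {x : (v.adicCompletionIntegers K')} {k : ℕ} {w : (v.adicCompletionIntegers K')}, IsUnit w → x = 2 ^ k * w →
      Valued.v (x : (v.adicCompletion K')) = exp (-(k : ℤ)) := by
    rintro x k w hw rfl
    push_cast
    rw [Valuation.map_mul, Valuation.map_pow, h2v, ← exp_nsmul, nsmul_eq_mul, mul_neg, mul_one,
      adicCompletionIntegers.isUnit_iff_valued_eq_one.mp hw, mul_one]
  have hN₁ : Valued.v (N.a₁ : (v.adicCompletion K')) ≤ exp (-(k₁ : ℤ)) := hle ha₁
  have hN₂ : Valued.v (N.a₂ : (v.adicCompletion K')) ≤ exp (-(k₂ : ℤ)) := hle ha₂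
  have hN₄ : Valued.v (N.a₄ : (v.adicCompletion K')) ≤ exp (-(k₄ : ℤ)) := hle ha₄
  have hN₈ : Valued.v (N.b₈ : (v.adicCompletion K')) ≤ exp (-(k₈ : ℤ)) := hle hb₈
  have hN₃ : Valued.v (N.a₃ : (v.adicCompletion K')) ≤ exp (-(k₃ : ℤ)) := hle ha₃
  have hN₆ : Valued.v (N.a₆ : (v.adicCompletion K')) = exp (-(k₆ : ℤ)) := heq hr ha₆
  have hN₆c : Valued.v ((N.a₆ : (v.adicCompletion K')) - (c₆ : v.adicCompletion K')) ≤ exp (-(k₆' : ℤ)) := by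
    have := hle ha₆c
    push_cast at this
    exact this
  have hNΔ0 : N.Δ ≠ 0 := by
    rw [hΔN]; exact mul_ne_zero (pow_ne_zero _ (Units.ne_zero _)) hΔM0
  have hNΔ : Valued.v (N.Δ : (v.adicCompletion K')) = exp (-(n : ℤ)) := by
    obtain ⟨m, u₀, hmu⟩ := eq_unit_mul_pow_irreducible hNΔ0 h2irr
    have hm : m = n := by
      have h := addVal_def N.Δ u₀ h2irr m hmu
      rw [← hΔn, h]; simp
    rw [hmu]
    push_cast
    rw [Valuation.map_mul, Valuation.map_pow, h2v, ← exp_nsmul, nsmul_eq_mul, mul_neg, mul_one,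
      adicCompletionIntegers.isUnit_iff_valued_eq_one.mp (Units.isUnit u₀), one_mul, hm]
  -- the `K_v`-model `C • X_v = N`
  obtain ⟨C₀, hC₀⟩ : ∃ C₀ : VariableChange (v.adicCompletion K'), C₀ • X.baseChange (v.adicCompletion K') = X.localMinimalModel v :=
    ⟨_, rfl⟩
  have hMK : M.map (algebraMap (v.adicCompletionIntegers K') (v.adicCompletion K')) = X.localMinimalModel v := by
    rw [hM, localMinimalIntegralModel]
    exact baseChange_integralModel_eq (v.adicCompletionIntegers K') (X.localMinimalModel v)
  set C : VariableChange (v.adicCompletion K') := D.map (algebraMap (v.adicCompletionIntegers K') (v.adicCompletion K')) * C₀ with hC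
  set Xv := X.baseChange (v.adicCompletion K') with hXv
  have hNK : N.map (algebraMap (v.adicCompletionIntegers K') (v.adicCompletion K')) = C • Xv := by
    rw [hC, mul_smul, hXv, hC₀, ← hMK, hN, map_variableChange]
  have hC₁ : Valued.v (C • Xv).a₁ ≤ exp (-(k₁ : ℤ)) := by rw [← hNK, map_a₁]; exact hN₁
  have hC₂ : Valued.v (C • Xv).a₂ ≤ exp (-(k₂ : ℤ)) := by rw [← hNK, map_a₂]; exact hN₂
  have hC₃ : Valued.v (C • Xv).a₃ ≤ exp (-(k₃ : ℤ)) := by rw [← hNK, map_a₃]; exact hN₃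
  have hC₆c : Valued.v ((C • Xv).a₆ - (c₆ : v.adicCompletion K')) ≤ exp (-(k₆' : ℤ)) := by
    rw [← hNK, map_a₆]; exact hN₆c
  have hC₄ : Valued.v (C • Xv).a₄ ≤ exp (-(k₄ : ℤ)) := by rw [← hNK, map_a₄]; exact hN₄
  have hC₆ : Valued.v (C • Xv).a₆ = exp (-(k₆ : ℤ)) := by rw [← hNK, map_a₆]; exact hN₆
  have hC₈ : Valued.v (C • Xv).b₈ ≤ exp (-(k₈ : ℤ)) := by rw [← hNK, map_b₈]; exact hN₈
  have hCΔ : Valued.v (C • Xv).Δ = exp (-(n : ℤ)) := by rw [← hNK, map_Δ]; exact hNΔ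
  -- continuity of `b₈` in the parameters
  have hb₈c : Continuous fun p ↦ (Xv.polyVariableChange p).b₈ := by
    have h1 := Xv.continuous_polyVariableChange_a₁
    have h2 := Xv.continuous_polyVariableChange_a₂
    have h3 := Xv.continuous_polyVariableChange_a₃
    have h4 := Xv.continuous_polyVariableChange_a₄
    have h6 := Xv.continuous_polyVariableChange_a₆
    simp only [WeierstrassCurve.b₈]
    exact ((((h1.pow 2).mul h6).add ((continuous_const.mul h2).mul h6)).sub
      ((h1.mul h3).mul h4)).add (h2.mul (h3.pow 2)) |>.sub (h4.pow 2)
  -- approximation of `(u⁻¹, r, s, t)` by elements of `K`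
  have hu0 : Valued.v (↑C.u⁻¹ : (v.adicCompletion K')) ≠ 0 := by simp
  set p₀ : (v.adicCompletion K') × (v.adicCompletion K') × (v.adicCompletion K') × (v.adicCompletion K') := ((↑C.u⁻¹ : (v.adicCompletion K')), C.r, C.s, C.t) with hp₀_def
  set S : Set ((v.adicCompletion K') × (v.adicCompletion K') × (v.adicCompletion K') × (v.adicCompletion K')) :=
    {p | Valued.v p.1 = Valued.v (↑C.u⁻¹ : (v.adicCompletion K'))} ∩
      ({p | Valued.v (Xv.polyVariableChange p).a₁ ≤ exp (-(k₁ : ℤ))} ∩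
      {p | Valued.v (Xv.polyVariableChange p).a₂ ≤ exp (-(k₂ : ℤ))} ∩
      {p | N.a₂ = 0 ∨ Valued.v (Xv.polyVariableChange p).a₂ = Valued.v (N.a₂ : (v.adicCompletion K'))} ∩
      {p | Valued.v (Xv.polyVariableChange p).a₃ ≤ exp (-(k₃ : ℤ))} ∩
      {p | N.a₃ = 0 ∨ Valued.v (Xv.polyVariableChange p).a₃ = Valued.v (N.a₃ : (v.adicCompletion K'))} ∩
      {p | Valued.v (Xv.polyVariableChange p).a₄ ≤ exp (-(k₄ : ℤ))} ∩
      {p | N.a₄ = 0 ∨ Valued.v (Xv.polyVariableChange p).a₄ = Valued.v (N.a₄ : (v.adicCompletion K'))} ∩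
      {p | Valued.v (Xv.polyVariableChange p).a₆ = exp (-(k₆ : ℤ))} ∩
      {p | Valued.v ((Xv.polyVariableChange p).a₆ - (c₆ : v.adicCompletion K')) ≤ exp (-(k₆' : ℤ))} ∩
      {p | Valued.v (Xv.polyVariableChange p).b₈ ≤ exp (-(k₈ : ℤ))} ∩
      {p | N.b₈ = 0 ∨ Valued.v (Xv.polyVariableChange p).b₈ = Valued.v (N.b₈ : (v.adicCompletion K'))}) with hS_def
  have hp₀ : C • Xv = Xv.polyVariableChange p₀ := variableChange_eq_polyVariableChange Xv C
  have hexact : ∀ {f : (v.adicCompletion K') × (v.adicCompletion K') × (v.adicCompletion K') × (v.adicCompletion K') → (v.adicCompletion K')} (_ : Continuous f) {k : ℕ}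
      (_ : Valued.v (f p₀) = exp (-(k : ℤ))), {p | Valued.v (f p) = exp (-(k : ℤ))} ∈ nhds p₀ := by
    intro f hf k hfk
    have hT := Valued.locally_const (x := f p₀) (by rw [hfk]; exact exp_ne_zero)
    have h := hf.continuousAt.preimage_mem_nhds hT
    simpa only [Set.preimage_setOf_eq, hfk] using h
  have hS : S ∈ nhds p₀ := by
    refine Filter.inter_mem ?_ (Filter.inter_mem (Filter.inter_mem (Filter.inter_mem (Filter.inter_mem
      (Filter.inter_mem (Filter.inter_mem (Filter.inter_mem (Filter.inter_mem (Filter.inter_mem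
      (Filter.inter_mem ?_ ?_) ?_) ?_) ?_) ?_) ?_) ?_) ?_) ?_) ?_)
    · exact continuous_fst.continuousAt.preimage_mem_nhds (Valued.locally_const hu0)
    · refine (Xv.continuous_polyVariableChange_a₁).continuousAt.preimage_mem_nhds
        (setOf_valued_le_exp_mem_nhds v _ ?_)
      rw [← hp₀]; exact hC₁
    · refine (Xv.continuous_polyVariableChange_a₂).continuousAt.preimage_mem_nhds
        (setOf_valued_le_exp_mem_nhds v _ ?_)
      rw [← hp₀]; exact hC₂
    · by_cases hN0 : N.a₂ = 0
      · exact Filter.univ_mem' fun p ↦ Or.inl hN0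
      · have ha₂0 : Valued.v (Xv.polyVariableChange p₀).a₂ = Valued.v (N.a₂ : (v.adicCompletion K')) := by
          rw [← hp₀, ← hNK, map_a₂]; rfl
        have hne : Valued.v (Xv.polyVariableChange p₀).a₂ ≠ 0 := by
          rw [ha₂0, Valuation.ne_zero_iff]
          exact_mod_cast hN0
        have hT := Valued.locally_const (x := (Xv.polyVariableChange p₀).a₂) hne
        have h := (Xv.continuous_polyVariableChange_a₂).continuousAt.preimage_mem_nhds hT
        refine Filter.mem_of_superset h fun p hp ↦ Or.inr ?_
        simp only [Set.mem_preimage, Set.mem_setOf_eq] at hp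
        rw [hp, ha₂0]
    · refine (Xv.continuous_polyVariableChange_a₃).continuousAt.preimage_mem_nhds
        (setOf_valued_le_exp_mem_nhds v _ ?_)
      rw [← hp₀]; exact hC₃
    · by_cases hN0 : N.a₃ = 0
      · exact Filter.univ_mem' fun p ↦ Or.inl hN0
      · have ha₃0 : Valued.v (Xv.polyVariableChange p₀).a₃ = Valued.v (N.a₃ : (v.adicCompletion K')) := by
          rw [← hp₀, ← hNK, map_a₃]; rfl
        have hne : Valued.v (Xv.polyVariableChange p₀).a₃ ≠ 0 := by
          rw [ha₃0, Valuation.ne_zero_iff]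
          exact_mod_cast hN0
        have hT := Valued.locally_const (x := (Xv.polyVariableChange p₀).a₃) hne
        have h := (Xv.continuous_polyVariableChange_a₃).continuousAt.preimage_mem_nhds hT
        refine Filter.mem_of_superset h fun p hp ↦ Or.inr ?_
        simp only [Set.mem_preimage, Set.mem_setOf_eq] at hp
        rw [hp, ha₃0]
    · refine (Xv.continuous_polyVariableChange_a₄).continuousAt.preimage_mem_nhds
        (setOf_valued_le_exp_mem_nhds v _ ?_)
      rw [← hp₀]; exact hC₄
    · by_cases hN0 : N.a₄ = 0
      · exact Filter.univ_mem' fun p ↦ Or.inl hN0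
      · have ha₄0 : Valued.v (Xv.polyVariableChange p₀).a₄ = Valued.v (N.a₄ : (v.adicCompletion K')) := by
          rw [← hp₀, ← hNK, map_a₄]; rfl
        have hne : Valued.v (Xv.polyVariableChange p₀).a₄ ≠ 0 := by
          rw [ha₄0, Valuation.ne_zero_iff]
          exact_mod_cast hN0
        have hT := Valued.locally_const (x := (Xv.polyVariableChange p₀).a₄) hne
        have h := (Xv.continuous_polyVariableChange_a₄).continuousAt.preimage_mem_nhds hT
        refine Filter.mem_of_superset h fun p hp ↦ Or.inr ?_
        simp only [Set.mem_preimage, Set.mem_setOf_eq] at hp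
        rw [hp, ha₄0]
    · exact hexact (Xv.continuous_polyVariableChange_a₆) (by rw [← hp₀]; exact hC₆)
    · have hc6 : Continuous fun p : (v.adicCompletion K') × (v.adicCompletion K') × (v.adicCompletion K') ×
          (v.adicCompletion K') ↦ (Xv.polyVariableChange p).a₆ - (c₆ : v.adicCompletion K') :=
        (Xv.continuous_polyVariableChange_a₆).sub continuous_const
      have h6c : {y : v.adicCompletion K' | Valued.v y ≤ exp (-(k₆' : ℤ))} ∈
          nhds ((Xv.polyVariableChange p₀).a₆ - (c₆ : v.adicCompletion K')) :=
        setOf_valued_le_exp_mem_nhds v _ (by rw [← hp₀]; exact hC₆c)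
      exact hc6.continuousAt.preimage_mem_nhds h6c
    · refine hb₈c.continuousAt.preimage_mem_nhds (setOf_valued_le_exp_mem_nhds v _ ?_)
      rw [← hp₀]; exact hC₈
    · by_cases hN0 : N.b₈ = 0
      · exact Filter.univ_mem' fun p ↦ Or.inl hN0
      · have hb₈0 : Valued.v (Xv.polyVariableChange p₀).b₈ = Valued.v (N.b₈ : (v.adicCompletion K')) := by
          rw [← hp₀, ← hNK, map_b₈]; rfl
        have hne : Valued.v (Xv.polyVariableChange p₀).b₈ ≠ 0 := by
          rw [hb₈0, Valuation.ne_zero_iff]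
          exact_mod_cast hN0
        have hT := Valued.locally_const (x := (Xv.polyVariableChange p₀).b₈) hne
        have h := hb₈c.continuousAt.preimage_mem_nhds hT
        refine Filter.mem_of_superset h fun p hp ↦ Or.inr ?_
        simp only [Set.mem_preimage, Set.mem_setOf_eq] at hp
        rw [hp, hb₈0]
  have hd : DenseRange φ := HeightOneSpectrum.denseRange_algebraMap K' v
  obtain ⟨⟨w', r', s', t'⟩, hwv, ⟨⟨⟨⟨⟨⟨⟨⟨⟨⟨h₁, h₂'⟩, h₂e⟩, h₃⟩, h₃'⟩, h₄⟩, h₄e⟩, h₆⟩, h₆c⟩, h₈⟩, h₈'⟩⟩ :=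
    (hd.prodMap (hd.prodMap (hd.prodMap hd))).mem_nhds hS
  simp only [Prod.map_apply, Set.mem_setOf_eq] at hwv h₁ h₂' h₂e h₃ h₃' h₄ h₄e h₆ h₆c h₈ h₈'
  have hw' : w' ≠ 0 := by
    rintro rfl
    rw [map_zero, Valuation.map_zero] at hwv
    exact hu0 hwv.symm
  set C' : VariableChange K' := ⟨(Units.mk0 w' hw')⁻¹, r', s', t'⟩ with hC'_def
  have hC'W : (C' • X).baseChange (v.adicCompletion K') = Xv.polyVariableChange (φ w', φ r', φ s', φ t') := by
    rw [variableChange_eq_polyVariableChange, baseChange, map_polyVariableChange]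
    simp [C', hXv, hφ, baseChange]
  have hval : ∀ x : K', v.valuation K' x = Valued.v (φ x) := fun x ↦ by
    rw [hφ, valued_algebraMap_adicCompletion]
  have hb₈K : φ (C' • X).b₈ = ((C' • X).baseChange (v.adicCompletion K')).b₈ := by
    simp only [baseChange, map_b₈]; rfl
  refine ⟨C', ?_, ?_, ?_, ?_, ?_, ?_, ?_, ?_, ?_, ?_, ?_, ?_⟩
  · rw [hval, show φ (C' • X).a₁ = ((C' • X).baseChange (v.adicCompletion K')).a₁ from rfl, hC'W]; exact h₁
  · rw [hval, show φ (C' • X).a₂ = ((C' • X).baseChange (v.adicCompletion K')).a₂ from rfl, hC'W]; exact h₂'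
  · intro m w hw hmw
    have hN0 : N.a₂ ≠ 0 := by
      rw [hmw]
      exact mul_ne_zero (pow_ne_zero _ h2irr.ne_zero) hw.ne_zero
    rw [hval, show φ (C' • X).a₂ = ((C' • X).baseChange (v.adicCompletion K')).a₂ from rfl, hC'W,
      h₂e.resolve_left hN0]
    exact heq hw hmw
  · rw [hval, show φ (C' • X).a₃ = ((C' • X).baseChange (v.adicCompletion K')).a₃ from rfl, hC'W]; exact h₃
  · intro m w hw hmw
    have hN0 : N.a₃ ≠ 0 := by
      rw [hmw]
      exact mul_ne_zero (pow_ne_zero _ h2irr.ne_zero) hw.ne_zero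
    rw [hval, show φ (C' • X).a₃ = ((C' • X).baseChange (v.adicCompletion K')).a₃ from rfl, hC'W,
      h₃'.resolve_left hN0]
    exact heq hw hmw
  · rw [hval, show φ (C' • X).a₄ = ((C' • X).baseChange (v.adicCompletion K')).a₄ from rfl, hC'W]; exact h₄
  · intro m w hw hmw
    have hN0 : N.a₄ ≠ 0 := by
      rw [hmw]
      exact mul_ne_zero (pow_ne_zero _ h2irr.ne_zero) hw.ne_zero
    rw [hval, show φ (C' • X).a₄ = ((C' • X).baseChange (v.adicCompletion K')).a₄ from rfl, hC'W,
      h₄e.resolve_left hN0]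
    exact heq hw hmw
  · rw [hval, show φ (C' • X).a₆ = ((C' • X).baseChange (v.adicCompletion K')).a₆ from rfl, hC'W]; exact h₆
  · rw [hval, map_sub, map_intCast,
      show φ (C' • X).a₆ = ((C' • X).baseChange (v.adicCompletion K')).a₆ from rfl, hC'W]; exact h₆c
  · rw [hval, hb₈K, hC'W]; exact h₈
  · intro m w hw hmw
    have hN0 : N.b₈ ≠ 0 := by
      rw [hmw]
      exact mul_ne_zero (pow_ne_zero _ h2irr.ne_zero) hw.ne_zero
    rw [hval, hb₈K, hC'W, h₈'.resolve_left hN0]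
    exact heq hw hmw
  · rw [hval, variableChange_Δ, inv_inv, Units.val_mk0, map_mul, map_pow, Valuation.map_mul,
      Valuation.map_pow, hwv, ← hCΔ, variableChange_Δ, Valuation.map_mul, Valuation.map_pow]
    simp only [hXv, baseChange, map_Δ]
    rfl

end Dedekind

end WeierstrassCurve

end Transfer

/-! ## §3. Over `ℚ`: the `C₆`-gauge of type `I₄*`, `ord₂ Δ_min = 14` -/

namespace WeierstrassCurve

open Literature.NumberTheory.EllipticCurves Literature.NumberTheory.GaloisRepresentations
  IsDedekindDomain.HeightOneSpectrum Rat.HeightOneSpectrum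

variable (X : WeierstrassCurve ℚ)

/-- **The twist by `2ε` of a curve in the `C₆`-gauge of type `I₄*`, `ord₂ Δ = 14`, has the shape of type
`IV*` after rescaling.**  Let `X/ℚ` have `ord₂(a₁) ≥ 2`, `ord₂(a₂) ≥ 1`, `ord₂(a₃) ≥ 7`, `ord₂(a₄) = 4`,
`ord₂(a₆) = 5`, `ord₂(b₂ - 8ε) ≥ 5`, `ord₂(a₆ - 32ε) ≥ 7` (`ε = ±1`) and `ord₂(Δ) = 14`.  Write
`a₁ = 4α₁`, `a₂ = 2P`, `a₃ = 128θ`, `a₄ = 16q`, `a₆ = 32r` (`q, r` units, `r ≡ ε`, `P + 2α₁² ≡ ε (mod 4)`).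
The twist `X^{(2ε)}` has `a₂ = 4ε(P + 2α₁²)`, `a₄ = 64(q + 16α₁θ)`, `a₆ = 256(εr + 128εθ²)`, `Δ = 2⁶Δ(X)`,
and under `(u; r, s, t) = (2; 0, 2, 16)` it becomes `a₁' = 2`, `a₂' = ε(P + 2α₁² - ε)`, `a₃' = 4`,
`a₄' = 4((q - 1) + 16α₁θ)`, `a₆' = 4(ε(r - ε) + 128εθ²)`, `Δ' = Δ/2⁶`: the shape
`(ord aᵢ) ≥ (1, 2, 2, 3, 4)`, `ord Δ = 8` of Kodaira type `IV*`.
[cite: SilvermanATAEC1994, IV.9.4 Steps 7–8 and Table 4.1] [cite: SilvermanAEC2009, X.5 Cor. 5.4] -/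
theorem exists_variableChange_quadraticTwist_two_mul_of_Istar_four_fourteen
    {v : HeightOneSpectrum (𝓞 ℚ)} (hv : (2 : 𝓞 ℚ) ∈ v.asIdeal) {ε : ℤ} (hε : ε = 1 ∨ ε = -1)
    (h₁ : v.valuation ℚ X.a₁ ≤ exp (-2 : ℤ)) (h₂ : v.valuation ℚ X.a₂ ≤ exp (-1 : ℤ))
    (h₃ : v.valuation ℚ X.a₃ ≤ exp (-7 : ℤ)) (h₄ : v.valuation ℚ X.a₄ = exp (-4 : ℤ))
    (h₆ : v.valuation ℚ X.a₆ = exp (-5 : ℤ)) (hb₂ε : v.valuation ℚ (X.b₂ - 8 * ε) ≤ exp (-5 : ℤ))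
    (h₆ε : v.valuation ℚ (X.a₆ - 32 * ε) ≤ exp (-7 : ℤ)) (hΔ : v.valuation ℚ X.Δ = exp (-14 : ℤ)) :
    ∃ C : VariableChange ℚ,
      v.valuation ℚ (C • X.quadraticTwist (2 * ε)).a₁ ≤ exp (-(1 : ℕ) : ℤ) ∧
      v.valuation ℚ (C • X.quadraticTwist (2 * ε)).a₂ ≤ exp (-(2 : ℕ) : ℤ) ∧
      v.valuation ℚ (C • X.quadraticTwist (2 * ε)).a₃ ≤ exp (-(2 : ℕ) : ℤ) ∧
      v.valuation ℚ (C • X.quadraticTwist (2 * ε)).a₄ ≤ exp (-(3 : ℕ) : ℤ) ∧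
      v.valuation ℚ (C • X.quadraticTwist (2 * ε)).a₆ ≤ exp (-(4 : ℕ) : ℤ) ∧
      v.valuation ℚ (C • X.quadraticTwist (2 * ε)).Δ = exp (-(8 : ℕ) : ℤ) := by
  have hv2 : natGenerator v = 2 := Rat.natGenerator_eq_two hv
  set Kv := v.adicCompletion ℚ with hKv
  set φ := algebraMap ℚ Kv with hφ
  have hval : ∀ x : ℚ, v.valuation ℚ x = Valued.v (φ x) := fun x ↦ by
    rw [hφ, valued_algebraMap_adicCompletion]
  have V2 : Valued.v (2 : Kv) = exp (-1 : ℤ) := valued_two v hv2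
  have h20 : (2 : Kv) ≠ 0 := by
    intro h; rw [h, Valuation.map_zero] at V2; exact exp_ne_zero V2.symm
  have hpow : ∀ n : ℕ, Valued.v ((2 : Kv) ^ n) = exp (-(n : ℤ)) := fun n ↦ by
    rw [Valuation.map_pow, V2, ← exp_nsmul]; simp
  have hpow0 : ∀ n : ℕ, ((2 : Kv) ^ n) ≠ 0 := fun n ↦ pow_ne_zero n h20
  have hexp : ∀ {a b : ℤ}, a ≤ b → exp a ≤ exp b := fun h ↦ exp_le_exp.mpr h
  have hscale : ∀ {x : Kv} (n : ℕ) {g : WithZero (Multiplicative ℤ)},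
      Valued.v (2 ^ n * x) ≤ exp (-(n : ℤ)) * g → Valued.v x ≤ g := by
    intro x n g h
    rw [show Valued.v x = Valued.v (2 ^ n * x) / exp (-(n : ℤ)) by
      rw [Valuation.map_mul, hpow, mul_div_cancel_left₀ _ exp_ne_zero],
      div_le_iff₀ (zero_lt_iff.mpr exp_ne_zero)]
    exact h.trans_eq (mul_comm _ _)
  have hscale' : ∀ {x : Kv} (n : ℕ) {g : WithZero (Multiplicative ℤ)},
      Valued.v (2 ^ n * x) = exp (-(n : ℤ)) * g → Valued.v x = g := by
    intro x n g h
    rw [show Valued.v x = Valued.v (2 ^ n * x) / exp (-(n : ℤ)) by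
      rw [Valuation.map_mul, hpow, mul_div_cancel_left₀ _ exp_ne_zero],
      div_eq_iff exp_ne_zero]
    exact h.trans (mul_comm _ _)
  have hεK : (ε : Kv) ^ 2 = 1 := by
    rcases hε with rfl | rfl <;> norm_num
  have hεv : Valued.v (ε : Kv) = 1 := by
    rcases hε with rfl | rfl <;> simp
  -- `a₁ = 4α₁`, `a₂ = 2P`, `a₃ = 128θ`, `a₄ = 16q`, `a₆ = 32r`
  set α₁ : Kv := φ X.a₁ / 2 ^ 2 with hα₁
  set P : Kv := φ X.a₂ / 2 ^ 1 with hP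
  set θ : Kv := φ X.a₃ / 2 ^ 7 with hθ
  set q : Kv := φ X.a₄ / 2 ^ 4 with hq
  set r : Kv := φ X.a₆ / 2 ^ 5 with hr
  have ha₁ : φ X.a₁ = 2 ^ 2 * α₁ := by rw [hα₁, mul_div_cancel₀ _ (hpow0 2)]
  have ha₂ : φ X.a₂ = 2 ^ 1 * P := by rw [hP, mul_div_cancel₀ _ (hpow0 1)]
  have ha₃ : φ X.a₃ = 2 ^ 7 * θ := by rw [hθ, mul_div_cancel₀ _ (hpow0 7)]
  have ha₄ : φ X.a₄ = 2 ^ 4 * q := by rw [hq, mul_div_cancel₀ _ (hpow0 4)]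
  have ha₆ : φ X.a₆ = 2 ^ 5 * r := by rw [hr, mul_div_cancel₀ _ (hpow0 5)]
  have hα₁v : Valued.v α₁ ≤ 1 := hscale 2 (by rw [← ha₁, ← hval, mul_one]; exact h₁)
  have hPv : Valued.v P ≤ 1 := hscale 1 (by rw [← ha₂, ← hval, mul_one]; simpa using h₂)
  have hθv : Valued.v θ ≤ 1 := hscale 7 (by rw [← ha₃, ← hval, mul_one]; exact h₃)
  have hqv : Valued.v q = 1 := hscale' 4 (by rw [← ha₄, ← hval, mul_one]; exact h₄)
  have hrv : Valued.v r = 1 := hscale' 5 (by rw [← ha₆, ← hval, mul_one]; exact h₆)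
  have hunit : ∀ {x : Kv}, Valued.v x = 1 → Valued.v (x - 1) ≤ exp (-1 : ℤ) := fun {x} hx ↦
    valued_le_exp_neg_one_of_lt_one v
      ((valued_lt_one_or_valued_sub_one_lt_one v hv2 hx.le).resolve_left (by rw [hx]; exact lt_irrefl 1))
  -- the sign: `v(r - ε) ≥ 2`
  have hrε : Valued.v (r - ε) ≤ exp (-2 : ℤ) := by
    refine hscale 5 ?_
    have e : (2 : Kv) ^ 5 * (r - ε) = φ (X.a₆ - 32 * ε) := by
      rw [map_sub, map_mul, map_ofNat, map_intCast, ha₆]; ring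
    rw [e, ← hval, ← exp_add]
    exact h₆ε.trans (hexp (by norm_num))
  -- the congruence: `v(P + 2α₁² - ε) ≥ 2` (`b₂ = 8(P + 2α₁²)`)
  have hb₂ : φ X.b₂ = 2 ^ 3 * (P + 2 * α₁ ^ 2) := by
    have : φ X.b₂ = (φ X.a₁) ^ 2 + 4 * φ X.a₂ := by
      simp only [WeierstrassCurve.b₂, map_add, map_mul, map_pow, map_ofNat]
    rw [this, ha₁, ha₂]; ring
  have hPε : Valued.v (P + 2 * α₁ ^ 2 - ε) ≤ exp (-2 : ℤ) := by
    refine hscale 3 ?_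
    have e : (2 : Kv) ^ 3 * (P + 2 * α₁ ^ 2 - ε) = φ (X.b₂ - 8 * ε) := by
      rw [map_sub, map_mul, map_ofNat, map_intCast, hb₂]; ring
    rw [e, ← hval, ← exp_add]
    exact hb₂ε.trans (hexp (by norm_num))
  -- the coefficients of `Xd = X.quadraticTwist (2ε)` in `K_v`
  set Xd := X.quadraticTwist (2 * ε) with hXd
  have hA₁ : Xd.a₁ = 0 := rfl
  have hA₃ : Xd.a₃ = 0 := rfl
  have h4Q : (4 : ℚ) ≠ 0 := by norm_num
  have h2Q : (2 : ℚ) ≠ 0 := two_ne_zero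
  have hA₂ : φ Xd.a₂ = 2 ^ 2 * (ε * (P + 2 * α₁ ^ 2)) := by
    have e : 4 * Xd.a₂ = (2 * ε) * X.b₂ := by
      rw [hXd, quadraticTwist_a₂, mul_div_cancel₀ _ h4Q]
    have e' := congrArg φ e
    rw [map_mul, map_ofNat, map_mul, map_mul, map_ofNat, map_intCast, hb₂] at e'
    apply mul_left_cancel₀ (hpow0 2)
    linear_combination e'
  have hA₄ : φ Xd.a₄ = 2 ^ 6 * (q + 2 ^ 4 * α₁ * θ) := by
    have e : 2 * Xd.a₄ = (2 * ε) ^ 2 * X.b₄ := by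
      rw [hXd, quadraticTwist_a₄, mul_div_cancel₀ _ h2Q]
    have e' := congrArg φ e
    simp only [WeierstrassCurve.b₄, map_mul, map_add, map_pow, map_ofNat, map_intCast] at e'
    rw [ha₁, ha₃, ha₄] at e'
    apply mul_left_cancel₀ h20
    linear_combination e' + (2 * (2 ^ 4 * q) + 2 ^ 2 * α₁ * (2 ^ 7 * θ)) * (4 : Kv) * hεK
  have hA₆ : φ Xd.a₆ = 2 ^ 8 * (ε * r + 2 ^ 7 * ε * θ ^ 2) := by
    have e : 4 * Xd.a₆ = (2 * ε) ^ 3 * X.b₆ := by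
      rw [hXd, quadraticTwist_a₆, mul_div_cancel₀ _ h4Q]
    have e' := congrArg φ e
    simp only [WeierstrassCurve.b₆, map_mul, map_add, map_pow, map_ofNat, map_intCast] at e'
    rw [ha₃, ha₆] at e'
    apply mul_left_cancel₀ (hpow0 2)
    linear_combination e' + (2 * ε * ((2 ^ 7 * θ) ^ 2 + 4 * (2 ^ 5 * r))) * (4 : Kv) * hεK
  have hΔd : φ Xd.Δ = 2 ^ 6 * φ X.Δ := by
    rw [hXd, quadraticTwist_Δ, map_mul, map_pow, map_mul, map_ofNat, map_intCast, mul_pow,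
      show ((ε : Kv)) ^ 6 = ((ε : Kv) ^ 2) ^ 3 by ring, hεK]
    ring
  -- the change of variables `(2; 0, 2, 16)`
  set u₂ : ℚˣ := Units.mk0 2 h2Q with hu₂
  have hu₂inv : ((u₂⁻¹ : ℚˣ) : ℚ) = 1 / 2 := by rw [Units.val_inv_eq_inv_val, hu₂, Units.val_mk0]; ring
  set C : VariableChange ℚ := ⟨u₂, 0, 2, 16⟩ with hC
  have c₁ : (C • Xd).a₁ = 2 := by rw [hC, variableChange_a₁, hA₁, hu₂inv]; ring
  have c₂ : 2 ^ 2 * (C • Xd).a₂ = Xd.a₂ - 4 := by rw [hC, variableChange_a₂, hA₁, hu₂inv]; ring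
  have c₃ : (C • Xd).a₃ = 4 := by rw [hC, variableChange_a₃, hA₁, hA₃, hu₂inv]; ring
  have c₄ : 2 ^ 4 * (C • Xd).a₄ = Xd.a₄ - 64 := by rw [hC, variableChange_a₄, hA₁, hA₃, hu₂inv]; ring
  have c₆ : 2 ^ 6 * (C • Xd).a₆ = Xd.a₆ - 256 := by rw [hC, variableChange_a₆, hA₁, hA₃, hu₂inv]; ring
  have cΔ : 2 ^ 12 * (C • Xd).Δ = Xd.Δ := by rw [hC, variableChange_Δ, hu₂inv]; ring
  have fromQ : ∀ {y z : ℚ} (n : ℕ) {g : WithZero (Multiplicative ℤ)},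
      (2 : ℚ) ^ n * y = z → Valued.v (φ z) ≤ exp (-(n : ℤ)) * g → v.valuation ℚ y ≤ g := by
    intro y z n g hyz hz
    rw [hval]
    refine hscale n ?_
    have : (2 : Kv) ^ n * φ y = φ z := by rw [← hyz, map_mul, map_pow, map_ofNat]
    rw [this]; exact hz
  have fromQ' : ∀ {y z : ℚ} (n : ℕ) {g : WithZero (Multiplicative ℤ)},
      (2 : ℚ) ^ n * y = z → Valued.v (φ z) = exp (-(n : ℤ)) * g → v.valuation ℚ y = g := by
    intro y z n g hyz hz
    rw [hval]
    refine hscale' n ?_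
    have : (2 : Kv) ^ n * φ y = φ z := by rw [← hyz, map_mul, map_pow, map_ofNat]
    rw [this]; exact hz
  refine ⟨C, ?_, ?_, ?_, ?_, ?_, ?_⟩
  · rw [c₁, hval, map_ofNat, V2]; exact hexp (by norm_num)
  · refine fromQ 2 c₂ ?_
    rw [map_sub, map_ofNat, hA₂,
      show (2 : Kv) ^ 2 * (ε * (P + 2 * α₁ ^ 2)) - 4 = 2 ^ 2 * (ε * (P + 2 * α₁ ^ 2 - ε)) by
        linear_combination (2 : Kv) ^ 2 * hεK,
      Valuation.map_mul, hpow, Valuation.map_mul, hεv, one_mul]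
    exact mul_le_mul' le_rfl (hPε.trans_eq (by norm_num))
  · rw [c₃, hval, map_ofNat, show (4 : Kv) = 2 ^ 2 by norm_num, hpow]
  · refine fromQ 4 c₄ ?_
    rw [map_sub, map_ofNat, hA₄,
      show (2 : Kv) ^ 6 * (q + 2 ^ 4 * α₁ * θ) - 64 = 2 ^ 6 * ((q - 1) + 2 ^ 4 * α₁ * θ) by ring,
      Valuation.map_mul, hpow]
    have hst : Valued.v ((q - 1) + 2 ^ 4 * α₁ * θ) ≤ exp (-1 : ℤ) := by
      refine Valuation.map_add_le _ (hunit hqv) ?_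
      rw [Valuation.map_mul, Valuation.map_mul, hpow]
      calc exp (-((4 : ℕ) : ℤ)) * Valued.v α₁ * Valued.v θ ≤ exp (-((4 : ℕ) : ℤ)) * 1 * 1 :=
            mul_le_mul' (mul_le_mul' le_rfl hα₁v) hθv
        _ ≤ exp (-1 : ℤ) := by rw [mul_one, mul_one]; exact hexp (by norm_num)
    refine (mul_le_mul' le_rfl hst).trans ?_
    push_cast
    rw [← exp_add, ← exp_add]; exact hexp (by norm_num)
  · refine fromQ 6 c₆ ?_
    rw [map_sub, map_ofNat, hA₆,
      show (2 : Kv) ^ 8 * (ε * r + 2 ^ 7 * ε * θ ^ 2) - 256 = 2 ^ 8 * (ε * (r - ε) + 2 ^ 7 * ε * θ ^ 2) by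
        linear_combination (2 : Kv) ^ 8 * hεK,
      Valuation.map_mul, hpow]
    push_cast
    rw [show exp (-6 : ℤ) * exp (-4 : ℤ) = exp (-8 : ℤ) * exp (-2 : ℤ) by
        rw [← exp_add, ← exp_add]; norm_num]
    refine mul_le_mul' le_rfl (Valuation.map_add_le _ ?_ ?_)
    · rw [Valuation.map_mul, hεv, one_mul]; exact hrε
    · rw [Valuation.map_mul, Valuation.map_mul, hpow, hεv, mul_one, Valuation.map_pow]
      calc exp (-((7 : ℕ) : ℤ)) * Valued.v θ ^ 2 ≤ exp (-((7 : ℕ) : ℤ)) * 1 ^ 2 :=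
            mul_le_mul' le_rfl (pow_le_pow_left' hθv 2)
        _ ≤ exp (-2 : ℤ) := by rw [one_pow, mul_one]; exact hexp (by norm_num)
  · refine fromQ' 12 cΔ ?_
    rw [hΔd, Valuation.map_mul, hpow, ← hval, hΔ, Nat.cast_ofNat, ← exp_add, ← exp_add]
    norm_num

end WeierstrassCurve

namespace WeierstrassCurve

open Literature.NumberTheory.EllipticCurves Literature.NumberTheory.GaloisRepresentations
  Literature.NumberTheory.DiophantineGeometry Literature.NumberTheory.DiophantineGeometry.TateAlgorithm
  IsDedekindDomain.HeightOneSpectrum Rat.HeightOneSpectrum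

variable (W : WeierstrassCurve ℚ)

/-- **`δ_v = ord_v(Δ_min) - (n + 6)` for Kodaira type `Iₙ*`** (`f_v = ord_v Δ_min + 1 - m_v` by the tree's
definition of the conductor exponent through Ogg's formula, `m_v = n + 5`, `ε_v = 2`); natural-number
subtraction, no hypothesis on `v`.  Silverman, *ATAEC*, Table 4.1 and IV.11.1.
[cite: SilvermanATAEC1994, IV.9 Table 4.1 and Thm. IV.11.1] -/
theorem wildConductorExponent_eq_of_kodairaSymbolAt_Istar {A : Type*} [CommRing A]
    [IsDedekindDomain A] {K' : Type*} [Field K'] [Algebra A K'] [IsFractionRing A K']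
    (v : HeightOneSpectrum A) (X : WeierstrassCurve K') (n : ℕ) (hT : X.kodairaSymbolAt v = .Istar n) :
    X.wildConductorExponent v = X.ordMinimalDiscriminant v - (n + 6) := by
  unfold wildConductorExponent conductorExponent numComponentsAt
  rw [hT]
  simp only [KodairaSymbol.numComponents, KodairaSymbol.tameConductorExponent]
  omega

/-- **From the gauge `a₃ = 0` of a Step-7 model (`Iₙ*`) with `4 ∣ a₁`, `a₂ = 2·unit`, `a₄ = 16·unit`,
`a₆ = 32·unit`, `ord Δ = 14` to a `ℚ`-model** (`v ∋ 2`): some `C • W` has `ord₂(a₁) ≥ 2`,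
`ord₂(a₂) = 1`, `ord₂(a₃) ≥ 7`, `ord₂(a₄) = 4`, `ord₂(a₆) = 5`, `ord₂(Δ) = 14`, and the signs: `a₆/32`
and `b₂/8 = a₂/2 + 2(a₁/4)²` are `2`-adic units, each `≡ 1` or `≡ -1 (mod 4)`
(`exists_variableChange_valuation_shape_of_two'`, `Rat.valuation_sub_eight_le_or_of_valuation_eq`).
[cite: SilvermanAEC2009, VII.1 Remark 1.1] [cite: SilvermanATAEC1994, IV.9.4 Step 7] -/
theorem exists_variableChange_of_Istar_succ_gauge [W.IsElliptic] {v : HeightOneSpectrum (𝓞 ℚ)}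
    (hv : (2 : 𝓞 ℚ) ∈ v.asIdeal) (D : VariableChange (v.adicCompletionIntegers ℚ))
    (h₁ : (2 : v.adicCompletionIntegers ℚ) ^ 2 ∣ (D • W.localMinimalIntegralModel v).a₁)
    (h₂ : ∃ p : v.adicCompletionIntegers ℚ, IsUnit p ∧ (D • W.localMinimalIntegralModel v).a₂ = 2 ^ 1 * p)
    (h₃ : (D • W.localMinimalIntegralModel v).a₃ = 0)
    (h₄ : ∃ q : v.adicCompletionIntegers ℚ, IsUnit q ∧ (D • W.localMinimalIntegralModel v).a₄ = 2 ^ 4 * q)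
    (h₆ : ∃ r : v.adicCompletionIntegers ℚ, IsUnit r ∧ (D • W.localMinimalIntegralModel v).a₆ = 2 ^ 5 * r)
    (hΔ : (IsDiscreteValuationRing.addVal (v.adicCompletionIntegers ℚ)
      (D • W.localMinimalIntegralModel v).Δ).toNat = 14) :
    ∃ C : VariableChange ℚ,
      v.valuation ℚ (C • W).a₁ ≤ exp (-2 : ℤ) ∧ v.valuation ℚ (C • W).a₂ = exp (-1 : ℤ) ∧
      v.valuation ℚ (C • W).a₃ ≤ exp (-7 : ℤ) ∧ v.valuation ℚ (C • W).a₄ = exp (-4 : ℤ) ∧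
      v.valuation ℚ (C • W).a₆ = exp (-5 : ℤ) ∧ v.valuation ℚ (C • W).Δ = exp (-14 : ℤ) ∧
      (v.valuation ℚ ((C • W).a₆ - 32) ≤ exp (-7 : ℤ) ∨ v.valuation ℚ ((C • W).a₆ + 32) ≤ exp (-7 : ℤ)) ∧
      (v.valuation ℚ ((C • W).b₂ - 8) ≤ exp (-5 : ℤ) ∨ v.valuation ℚ ((C • W).b₂ + 8) ≤ exp (-5 : ℤ)) := by
  have h2 := Rat.valuation_two_of_two_mem hv
  obtain ⟨p, hp, ha₂⟩ := h₂
  obtain ⟨q, hq, ha₄⟩ := h₄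
  have ha₃ : (2 : v.adicCompletionIntegers ℚ) ^ 7 ∣ (D • W.localMinimalIntegralModel v).a₃ := by
    rw [h₃]; exact dvd_zero _
  have ha₆c : (2 : v.adicCompletionIntegers ℚ) ^ 0 ∣ ((D • W.localMinimalIntegralModel v).a₆ - (0 : ℤ)) :=
    ⟨_, (one_mul _).symm⟩
  have hb₈ : (2 : v.adicCompletionIntegers ℚ) ^ 0 ∣ (D • W.localMinimalIntegralModel v).b₈ :=
    ⟨_, (one_mul _).symm⟩
  obtain ⟨-, C, g₁, -, g₂e, g₃, -, -, g₄e, g₆, -, -, -, gΔ⟩ := W.exists_variableChange_valuation_shape_of_two' v h2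
    (k₁ := 2) (k₂ := 1) (k₃ := 7) (k₄ := 4) (k₆ := 5) (k₈ := 0) (n := 14) D
    h₁ ⟨p, ha₂⟩ ha₃ ⟨q, ha₄⟩ h₆ 0 ha₆c hb₈ hΔ
  have g₂ : v.valuation ℚ (C • W).a₂ = exp (-1 : ℤ) := by simpa using g₂e hp ha₂
  have g₄ : v.valuation ℚ (C • W).a₄ = exp (-4 : ℤ) := by simpa using g₄e hq ha₄
  have g₁' : v.valuation ℚ (C • W).a₁ ≤ exp (-2 : ℤ) := by simpa using g₁
  have g₆' : v.valuation ℚ (C • W).a₆ = exp (-5 : ℤ) := by simpa using g₆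
  -- `v(b₂) = v(4a₂) = 2⁻³`
  have hb₂ : v.valuation ℚ (C • W).b₂ = exp (-3 : ℤ) := by
    have h4 : v.valuation ℚ (4 * (C • W).a₂) = exp (-3 : ℤ) := by
      rw [Valuation.map_mul, show (4 : ℚ) = 2 ^ 2 by norm_num, Valuation.map_pow, h2, g₂, ← exp_nsmul,
        ← exp_add]; norm_num
    rw [WeierstrassCurve.b₂, Valuation.map_add_eq_of_lt_right]
    · exact h4
    · rw [h4, Valuation.map_pow]
      calc v.valuation ℚ (C • W).a₁ ^ 2 ≤ (exp (-2 : ℤ)) ^ 2 := pow_le_pow_left' g₁' 2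
        _ < exp (-3 : ℤ) := by rw [← exp_nsmul, exp_lt_exp]; norm_num
  refine ⟨C, g₁', g₂, by simpa using g₃, g₄, g₆', by simpa using gΔ, ?_, ?_⟩
  · -- `a₆ = 4·(a₆/4)` with `v(a₆/4) = 2⁻³`
    have h4 : v.valuation ℚ (4 : ℚ) = exp (-2 : ℤ) := by
      rw [show (4 : ℚ) = 2 ^ 2 by norm_num, Valuation.map_pow, h2, ← exp_nsmul]; norm_num
    have hq : v.valuation ℚ ((C • W).a₆ / 4) = exp (-3 : ℤ) := by
      rw [map_div₀, g₆', h4, ← exp_sub]; norm_num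
    rcases Rat.valuation_sub_eight_le_or_of_valuation_eq hv hq with h | h
    · left
      rw [show (C • W).a₆ - 32 = 4 * ((C • W).a₆ / 4 - 8) by ring, Valuation.map_mul, h4,
        show exp (-7 : ℤ) = exp (-2 : ℤ) * exp (-5 : ℤ) by rw [← exp_add]; norm_num]
      exact mul_le_mul' le_rfl h
    · right
      rw [show (C • W).a₆ + 32 = 4 * ((C • W).a₆ / 4 + 8) by ring, Valuation.map_mul, h4,
        show exp (-7 : ℤ) = exp (-2 : ℤ) * exp (-5 : ℤ) by rw [← exp_add]; norm_num]
      exact mul_le_mul' le_rfl h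
  · exact Rat.valuation_sub_eight_le_or_of_valuation_eq hv hb₂

/-- **The twist by `2ε` of a `C₆`-curve of type `I₄*` in the gauge above (`a₆ ≡ 32ε (mod 128)`,
`b₂ ≡ 8ε (mod 32)`) is potentially good over `ℚ(∛2)`** (the type-`IV*` shape of
`(2; 0, 2, 16) • (C • W)^{(2ε)}`, `exists_variableChange_quadraticTwist_two_mul_of_Istar_four_fourteen`,
transported to `W^{(2ε)}` by `quadraticTwist_smul`; `hasGoodReductionAt_baseChange_of_pow_three_eq` with
`j = 2`). [cite: SilvermanATAEC1994, IV.9.4 Steps 6–8; proof of Thm. IV.10.2(b) (PDF pp. 359–361)]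
[cite: SilvermanAEC2009, VII.5 Prop. 5.4, X.5 Cor. 5.4] -/
theorem hasGoodReductionAt_baseChange_quadraticTwist_two_mul_of_Istar_four_fourteen
    {v : HeightOneSpectrum (𝓞 ℚ)} (hv : (2 : 𝓞 ℚ) ∈ v.asIdeal) {ε : ℤ} (hε : ε = 1 ∨ ε = -1)
    (C : VariableChange ℚ)
    (h₁ : v.valuation ℚ (C • W).a₁ ≤ exp (-2 : ℤ)) (h₂ : v.valuation ℚ (C • W).a₂ ≤ exp (-1 : ℤ))
    (h₃ : v.valuation ℚ (C • W).a₃ ≤ exp (-7 : ℤ)) (h₄ : v.valuation ℚ (C • W).a₄ = exp (-4 : ℤ))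
    (h₆ : v.valuation ℚ (C • W).a₆ = exp (-5 : ℤ))
    (hb₂ε : v.valuation ℚ ((C • W).b₂ - 8 * ε) ≤ exp (-5 : ℤ))
    (h₆ε : v.valuation ℚ ((C • W).a₆ - 32 * ε) ≤ exp (-7 : ℤ)) (hΔ : v.valuation ℚ (C • W).Δ = exp (-14 : ℤ))
    (L : Type*) [Field L] [NumberField L] [Algebra ℚ L] {β : L} (hβ : β ^ 3 = 2)
    {w : HeightOneSpectrum (𝓞 L)} (hw : w.asIdeal.under (𝓞 ℚ) = v.asIdeal) :
    ((W.quadraticTwist (2 * ε)).baseChange L).HasGoodReductionAt w := by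
  obtain ⟨C', g₁, g₂, g₃, g₄, g₆, gΔ⟩ :=
    (C • W).exists_variableChange_quadraticTwist_two_mul_of_Istar_four_fourteen hv hε h₁ h₂ h₃ h₄ h₆ hb₂ε
      h₆ε hΔ
  have htw : (C • W).quadraticTwist (2 * ε) =
      (⟨C.u, (2 * ε) * C.r, 0, 0⟩ : VariableChange ℚ) • W.quadraticTwist (2 * ε) := by
    exact_mod_cast quadraticTwist_smul W C ((2 * ε : ℤ) : ℚ)
  rw [htw, ← mul_smul] at g₁ g₂ g₃ g₄ g₆ gΔ
  have hβ' : β ^ 3 = algebraMap ℚ L 2 := by rw [hβ, map_ofNat]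
  exact (W.quadraticTwist (2 * ε)).hasGoodReductionAt_baseChange_of_pow_three_eq L
    (Rat.valuation_two_of_two_mem hv) hβ' 2 _ g₁ g₂ g₃ g₄ g₆ gΔ
    (by norm_num) (by norm_num) (by norm_num) (by norm_num) (by norm_num) (by norm_num) hw

variable (ℓ : ℕ) [Fact ℓ.Prime]

/-- **`Sw_𝔓(V_ℓ E) = 4` for the `C₆`-curves of type `I₄*`, `ord₂ Δ_min = 14`, in the gauge above**
(`ℓ ≠ 2`, `𝔓 ∣ 2`): `E^{(2ε)}` is potentially good over `ℚ(∛2)`, and the break of `ℚ₂(√(2ε))` is `2`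
(`swanConductorAt_rationalTate_eq_four_of_quadraticTwist_of_emod_four_eq_two`).  These are the twists by
`χ_{±2}` of the curves of type `IV*` with `a₁/2` odd; Silverman, *ATAEC* IV.9 Table 4.1 (type `I₄*`,
`f = 6`, `ord₂ Δ = 14`) with Thm. IV.10.2(b).
[cite: SilvermanATAEC1994, IV.9 Table 4.1, Thm. IV.10.2(b) (PDF pp. 358–361)] [cite: SerreTate1968, §3] -/
theorem swanConductorAt_rationalTate_eq_four_of_Istar_four_fourteen [W.IsElliptic]
    (h : Continuous fun x : absoluteGaloisGroup ℚ × RationalTateModule (geomPoints W) ℓ ↦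
      rationalTateRepresentation (absoluteGaloisGroup ℚ) (geomPoints W) ℓ x.1 x.2)
    {v : HeightOneSpectrum (𝓞 ℚ)} (hv : (2 : 𝓞 ℚ) ∈ v.asIdeal) (hℓ : (ℓ : 𝓞 ℚ) ∉ v.asIdeal)
    {ε : ℤ} (hε : ε = 1 ∨ ε = -1) (C : VariableChange ℚ)
    (h₁ : v.valuation ℚ (C • W).a₁ ≤ exp (-2 : ℤ)) (h₂ : v.valuation ℚ (C • W).a₂ ≤ exp (-1 : ℤ))
    (h₃ : v.valuation ℚ (C • W).a₃ ≤ exp (-7 : ℤ)) (h₄ : v.valuation ℚ (C • W).a₄ = exp (-4 : ℤ))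
    (h₆ : v.valuation ℚ (C • W).a₆ = exp (-5 : ℤ))
    (hb₂ε : v.valuation ℚ ((C • W).b₂ - 8 * ε) ≤ exp (-5 : ℤ))
    (h₆ε : v.valuation ℚ ((C • W).a₆ - 32 * ε) ≤ exp (-7 : ℤ)) (hΔ : v.valuation ℚ (C • W).Δ = exp (-14 : ℤ))
    {𝔓 : Ideal (absIntegers (𝓞 ℚ) ℚ)} (h𝔓 : 𝔓 ∈ v.primesAbove) :
    (rationalTateGaloisRepOf (geomPoints W) ℓ h).swanConductorAt (𝓞 ℚ) 𝔓 = 4 := by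
  have hd : (2 * ε) % 4 = 2 := by rcases hε with rfl | rfl <;> decide
  exact W.swanConductorAt_rationalTate_eq_four_of_quadraticTwist_of_emod_four_eq_two ℓ h hv hℓ hd
    (fun L _ _ _ β hβ w hw ↦ by
      have := W.hasGoodReductionAt_baseChange_quadraticTwist_two_mul_of_Istar_four_fourteen hv hε C h₁ h₂
        h₃ h₄ h₆ hb₂ε h₆ε hΔ L hβ hw
      simpa using this)
    h𝔓

attribute [local instance] AddSubgroup.torsionBy.zmodModule in
/-- **Ogg's formula at `2` for the `C₆`-curves of type `I₄*`, `ord₂ Δ_min = 14`, `3`-torsion form**: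
`Sw_𝔓(E[3]) = δ₂(E)`, both sides being `4` (`δ₂ = ord₂ Δ_min - 10` for type `I₄*`,
`wildConductorExponent_eq_of_kodairaSymbolAt_Istar`).
[cite: SilvermanATAEC1994, §IV.10 Definition of δ(E/K) (PDF p. 358), Thm. IV.11.1 (pp. 365–366), Table 4.1]
[cite: Saito1988, Theorem 1] -/
theorem swanConductorAt_torsion_eq_wildConductorExponent_of_Istar_four_fourteen [W.IsElliptic]
    {v : HeightOneSpectrum (𝓞 ℚ)} (hv : (2 : 𝓞 ℚ) ∈ v.asIdeal)
    (hT : W.kodairaSymbolAt v = .Istar 4) (hord : W.ordMinimalDiscriminant v = 14)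
    {ε : ℤ} (hε : ε = 1 ∨ ε = -1) (C : VariableChange ℚ)
    (h₁ : v.valuation ℚ (C • W).a₁ ≤ exp (-2 : ℤ)) (h₂ : v.valuation ℚ (C • W).a₂ ≤ exp (-1 : ℤ))
    (h₃ : v.valuation ℚ (C • W).a₃ ≤ exp (-7 : ℤ)) (h₄ : v.valuation ℚ (C • W).a₄ = exp (-4 : ℤ))
    (h₆ : v.valuation ℚ (C • W).a₆ = exp (-5 : ℤ))
    (hb₂ε : v.valuation ℚ ((C • W).b₂ - 8 * ε) ≤ exp (-5 : ℤ))
    (h₆ε : v.valuation ℚ ((C • W).a₆ - 32 * ε) ≤ exp (-7 : ℤ)) (hΔ : v.valuation ℚ (C • W).Δ = exp (-14 : ℤ))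
    {𝔓 : Ideal (absIntegers (𝓞 ℚ) ℚ)} (h𝔓 : 𝔓 ∈ v.primesAbove) :
    (W.torsionGaloisRep 3).swanConductorAt (𝓞 ℚ) 𝔓 = (W.wildConductorExponent v : ℝ) := by
  haveI : Fact (Nat.Prime 3) := ⟨Nat.prime_three⟩
  have h3 : ((3 : ℕ) : 𝓞 ℚ) ∉ v.asIdeal := by
    intro h3
    apply (Ideal.ne_top_iff_one v.asIdeal).mp v.isPrime.ne_top
    have := v.asIdeal.sub_mem h3 hv
    rwa [show ((3 : ℕ) : 𝓞 ℚ) - 2 = 1 by norm_num] at this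
  rw [← W.swanConductorAt_rationalTate_eq_swanConductorAt_torsion 3
    (W.continuous_rationalGaloisRepTate_holds 3) h3 h𝔓,
    W.swanConductorAt_rationalTate_eq_four_of_Istar_four_fourteen 3 _ hv h3 hε C h₁ h₂ h₃ h₄ h₆ hb₂ε h₆ε
      hΔ h𝔓,
    W.wildConductorExponent_eq_of_kodairaSymbolAt_Istar v 4 hT, hord]
  norm_num

end WeierstrassCurve

end
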